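import Summits.AtomisticToContinuum.HydrodynamicLimit.Theorems.AntiMazurCoboundariesInfluenceLocalityObjects

/-!
# Anchored covering, prelim 4: restrictions of Liouville-a.e. data are good cluster data

Prelim file of the registered stub `stub_anchoredCovering` (line `true-anchored-infection` of the
crux `InfluenceLocality`, stmt-AtomisticToContinuum-13916): the null set on which the forecast
worlds of the stub are genuine hard-sphere trajectories.

* `volume_preimage_restrictTo_null` — a Lebesgue-null set of `S.card`-particle data pulls back,
  under the coordinate projection `Config.restrictTo S` (keep the particles of `S`, relabelled
  increasingly), to a Lebesgue-null set of `M`-particle data: split the coordinates into those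
  in the range of the relabelling and the others (`MeasurableEquiv.piEquivPiSubtypeProd`, a
  measure-preserving equivalence for the product Lebesgue measure), so that the preimage is a
  product `B' × univ` of measure `volume B' · volume univ = 0 · ∞ = 0`;
* `ae_restrictTo_mem_good`, registered form **`anchoredCovering_nullSets`** — for every set of
  particles `S`, Liouville-a.e. `(N + 1)`-particle datum restricts to a GOOD datum of the cluster
  flow `Ψ S.card` (a sub-configuration of a non-overlapping configuration is non-overlapping, and
  the bad set of a hard-sphere flow is Liouville-null, `HardSphereFlow.measure_compl_good`).
-/

namespace Summit.AtomisticToContinuum.HydrodynamicLimit.Theorems.TrueAnchoredInfection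

open MeasureTheory Set Function
open scoped ENNReal
open Literature.Analysis.FluidPDE Literature.MathematicalPhysics.KineticTheory

noncomputable section

/-- A Lebesgue-null set of `S.card`-particle data pulls back, under the coordinate projection
`Config.restrictTo S`, to a Lebesgue-null set of `M`-particle data (product structure of the
Lebesgue measure: split the coordinates into `S` and its complement). -/
theorem volume_preimage_restrictTo_null {M : ℕ} (S : Finset (Fin M))
    {B : Set (Config S.card (Fin 3) T3)} (hB : MeasurableSet B) (hB0 : volume B = 0) :
    volume (Config.restrictTo S ⁻¹' B : Set (Config M (Fin 3) T3)) = 0 := by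
  classical
  haveI : SigmaFinite (volume : Measure (T3 × V3)) := inferInstance
  set f : Fin S.card → Fin M := fun m => S.orderEmbOfFin rfl m with hfdef
  have hf : Injective f := (S.orderEmbOfFin rfl).injective
  set p : Fin M → Prop := fun c => c ∈ Set.range f with hpdef
  set eqv : Fin S.card ≃ Subtype p := Equiv.ofInjective f hf with heqv
  -- relabelling `Subtype p → Fin S.card`
  set g : (Subtype p → T3 × V3) → Config S.card (Fin 3) T3 := fun y m => y (eqv m) with hgdef
  have hg : MeasurePreserving g volume volume := by
    have h := volume_measurePreserving_piCongrLeft (fun _ : Fin S.card => T3 × V3) eqv.symm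
    refine ⟨?_, ?_⟩
    · exact measurable_pi_lambda _ fun m => measurable_pi_apply _
    · have hfun : (MeasurableEquiv.piCongrLeft (fun _ : Fin S.card => T3 × V3) eqv.symm :
          (Subtype p → T3 × V3) → Config S.card (Fin 3) T3) = g := by
        funext y
        funext m
        simp only [MeasurableEquiv.coe_piCongrLeft, Equiv.piCongrLeft_apply_eq_cast, cast_eq,
          Equiv.symm_symm, hgdef]
      rw [← hfun]
      exact h.map_eq
  set PE := MeasurableEquiv.piEquivPiSubtypeProd (fun _ : Fin M => T3 × V3) p with hPEdef
  have hPE := volume_preserving_piEquivPiSubtypeProd (fun _ : Fin M => T3 × V3) p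
  have hfact : (Config.restrictTo S ⁻¹' B : Set (Config M (Fin 3) T3)) =
      PE ⁻¹' ((g ⁻¹' B) ×ˢ (Set.univ : Set ({c // ¬ p c} → T3 × V3))) := by
    ext z
    simp only [Set.mem_preimage, Set.mem_prod, Set.mem_univ, and_true, hPEdef,
      MeasurableEquiv.piEquivPiSubtypeProd_apply]
    exact Iff.rfl
  have hgB : MeasurableSet (g ⁻¹' B) := hg.measurable hB
  have hgB0 : volume (g ⁻¹' B) = 0 := by rw [hg.measure_preimage hB.nullMeasurableSet, hB0]
  have key : volume (g ⁻¹' B) * volume (Set.univ : Set ({c // ¬ p c} → T3 × V3)) = 0 := by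
    rw [hgB0, zero_mul]
  rw [hfact, hPE.measure_preimage (hgB.prod MeasurableSet.univ).nullMeasurableSet,
    Measure.volume_eq_prod, Measure.prod_prod]
  convert key

/-- For every set of particles `S`, Liouville-a.e. `(N + 1)`-particle datum restricts to a good
datum of the `S.card`-particle cluster flow (a sub-configuration of a non-overlapping
configuration is non-overlapping, and the bad set of the cluster flow is Liouville-null). -/
theorem ae_restrictTo_mem_good {σ : ℝ} {N : ℕ} (Ψ : ClusterFlows σ N) (S : Finset (Fin (N + 1))) :
    ∀ᵐ z ∂(liouville G3 (N + 1) (hsDiameter σ N)), Config.restrictTo S z ∈ (Ψ S.card).good := by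
  have hD : MeasurableSet (hardSphereDomain G3 (N + 1) (hsDiameter σ N) : Set (Phase N)) :=
    measurableSet_hardSphereDomain G3 Torus.measurable_geometry_sepVec _ _
  have hDk : MeasurableSet (hardSphereDomain G3 S.card (hsDiameter σ N) :
      Set (Config S.card (Fin 3) T3)) :=
    measurableSet_hardSphereDomain G3 Torus.measurable_geometry_sepVec _ _
  set B : Set (Config S.card (Fin 3) T3) :=
    (Ψ S.card).goodᶜ ∩ hardSphereDomain G3 S.card (hsDiameter σ N) with hBdef
  have hB : MeasurableSet B := (Ψ S.card).measurableSet_good.compl.inter hDk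
  have hB0 : volume B = 0 := by
    have h := (Ψ S.card).measure_compl_good
    rwa [liouville_eq, Measure.restrict_apply' hDk] at h
  have hsub : ∀ z : Phase N, z ∈ hardSphereDomain G3 (N + 1) (hsDiameter σ N) →
      Config.restrictTo S z ∈ hardSphereDomain G3 S.card (hsDiameter σ N) := by
    intro z hz m m' hmm
    exact hz _ _ ((S.orderEmbOfFin rfl).injective.ne hmm)
  rw [ae_iff, liouville_eq, Measure.restrict_apply' hD]
  refine measure_mono_null (fun z hz => ?_) (volume_preimage_restrictTo_null S hB hB0)
  exact ⟨hz.1, hsub z hz.2⟩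

/-- **Registered prelim statement** (stub `stub_anchoredCovering`, null sets): for every set of
particles `S`, Liouville-almost every `(N + 1)`-particle datum restricts to a good datum of the
cluster flow `Ψ S.card`. -/
theorem anchoredCovering_nullSets : ∀ {σ : ℝ} {N : ℕ} (Ψ : ClusterFlows σ N) (S : Finset (Fin (N + 1))), ∀ᵐ z ∂(liouville G3 (N + 1) (hsDiameter σ N)), Config.restrictTo S z ∈ (Ψ S.card).good :=
  fun Ψ S => ae_restrictTo_mem_good Ψ S

end

end Summit.AtomisticToContinuum.HydrodynamicLimit.Theorems.TrueAnchoredInfection
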